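import Summits.CriticalPhenomena.PercolationContinuityZ3.Theorems.PercNearOneGluingNoHeavyPcintBSMXZ5Cert
import HarnessLib

/-!
# PCINT lane, PHASE 6 (block renewal with reach-two pieces): kernel check of the Green table `G0` for `ℤ^5`, part 1/2

Cell `prim-pcint`, seat `prim-pcint-1` (gen 15); memo `run/shared/lean/prim/pcint/T-FIBRE-ROUTE.md` §PHASE 6.
Instance `d = 5 = 3 + 2` (`k = 3` time axes, the transverse plane), five-point law `(A₀, A₁, A₂)/DA =
(68, 13, 3)/100`, horizon `N = 150` (window half-width `60`), cell `p = 1826/10^4`. The windowed fixed-point Green sums (`BSMX.termsH`,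
rows `BSMX.hrowW`) are below the table `G0n` on the sorted offsets of `[-12,12]^2` — flat pieces of 7 offsets.
-/

namespace Summit.CriticalPhenomena.PercolationContinuityZ3.Theorems.Pcint.BSMX.Z5

open Summit.CriticalPhenomena.PercolationContinuityZ3.Theorems.Pcint.BSMX Summit.CriticalPhenomena.PercolationContinuityZ3.Theorems.Pcint.BSM

set_option maxHeartbeats 0 in
set_option maxRecDepth 65536 in
/-- `G0 ≤ table` on the sorted offsets (CL212.take 7). -/
theorem hG0_1 : ∀ δ ∈ (CL212.take 7), GqN (termsH 68 13 3 100 1000000000000000 60 150 12 Ul) 12 δ * 1000000000000 ≤ G0n δ * (1000000000000000 * 1000000000000000 ^ 2) := by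
  decide +kernel
set_option maxHeartbeats 0 in
set_option maxRecDepth 65536 in
/-- `G0 ≤ table` on the sorted offsets ((CL212.drop 7).take 7). -/
theorem hG0_2 : ∀ δ ∈ ((CL212.drop 7).take 7), GqN (termsH 68 13 3 100 1000000000000000 60 150 12 Ul) 12 δ * 1000000000000 ≤ G0n δ * (1000000000000000 * 1000000000000000 ^ 2) := by
  decide +kernel
set_option maxHeartbeats 0 in
set_option maxRecDepth 65536 in
/-- `G0 ≤ table` on the sorted offsets ((CL212.drop 14).take 7). -/
theorem hG0_3 : ∀ δ ∈ ((CL212.drop 14).take 7), GqN (termsH 68 13 3 100 1000000000000000 60 150 12 Ul) 12 δ * 1000000000000 ≤ G0n δ * (1000000000000000 * 1000000000000000 ^ 2) := by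
  decide +kernel
set_option maxHeartbeats 0 in
set_option maxRecDepth 65536 in
/-- `G0 ≤ table` on the sorted offsets ((CL212.drop 21).take 7). -/
theorem hG0_4 : ∀ δ ∈ ((CL212.drop 21).take 7), GqN (termsH 68 13 3 100 1000000000000000 60 150 12 Ul) 12 δ * 1000000000000 ≤ G0n δ * (1000000000000000 * 1000000000000000 ^ 2) := by
  decide +kernel
set_option maxHeartbeats 0 in
set_option maxRecDepth 65536 in
/-- `G0 ≤ table` on the sorted offsets ((CL212.drop 28).take 7). -/
theorem hG0_5 : ∀ δ ∈ ((CL212.drop 28).take 7), GqN (termsH 68 13 3 100 1000000000000000 60 150 12 Ul) 12 δ * 1000000000000 ≤ G0n δ * (1000000000000000 * 1000000000000000 ^ 2) := by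
  decide +kernel
set_option maxHeartbeats 0 in
set_option maxRecDepth 65536 in
/-- `G0 ≤ table` on the sorted offsets ((CL212.drop 35).take 7). -/
theorem hG0_6 : ∀ δ ∈ ((CL212.drop 35).take 7), GqN (termsH 68 13 3 100 1000000000000000 60 150 12 Ul) 12 δ * 1000000000000 ≤ G0n δ * (1000000000000000 * 1000000000000000 ^ 2) := by
  decide +kernel
set_option maxHeartbeats 0 in
set_option maxRecDepth 65536 in
/-- `G0 ≤ table` on the sorted offsets ((CL212.drop 42).take 7). -/
theorem hG0_7 : ∀ δ ∈ ((CL212.drop 42).take 7), GqN (termsH 68 13 3 100 1000000000000000 60 150 12 Ul) 12 δ * 1000000000000 ≤ G0n δ * (1000000000000000 * 1000000000000000 ^ 2) := by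
  decide +kernel

end Summit.CriticalPhenomena.PercolationContinuityZ3.Theorems.Pcint.BSMX.Z5
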